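import Literature.Geometry.Kaehler.ComplexTorusAndreDaggerPullbackAdjoint
import Mathlib.Analysis.LocallyConvex.SeparatingDual
import HarnessLib

/-!
# `†`-self-adjoint pull-backs are exactly the pull-backs by `η`-self-adjoint maps: `(M^*)† = M^* ⟺ M′ = M`; on `End(X)` André's `†`-symmetric
# elements are the ROSATI-SYMMETRIC ones (`(ρ(A)^*)† = ρ(A)^* ⟺ G⁻¹ ᵗA G = A`)

Layer `Literature/Geometry/Kaehler`, namespace `Literature.Geometry.Kaehler.ComplexTorus`; lane `lit-hodgefound` (Track 2 foundations library),
prover seat `lit-hodgefound-p35` (generation 53, row g53-#9; sequel of g53-#4 `ComplexTorusAndreDaggerPullbackAdjoint` — `(M^*)† = (M′)^*`).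
THEOREMS ONLY: no definition, no named fact, no instance, no notation; D-0026 net debt `0`.

THE POINT. Row g53-#4 identified André's involution on pull-backs with `M ↦ M′`. Since `M ↦ M^*` is INJECTIVE (§1: the covectors `θ ∘ M` recover `M`, the real
dual separating points), the `†`-SELF-ADJOINT pull-backs are exactly the pull-backs by `η`-SELF-ADJOINT maps (`η(Mu, v) = η(u, Mv)`), and on the real-analytic
representations `ρ(A)` the `†`-symmetric ones are exactly the ROSATI-SYMMETRIC matrices `A′ = G_ℝ⁻¹ ᵗA G_ℝ = A` — Lange's symmetric elements
`End^s(X) = {f | f′ = f}` (§5.2: `NS_ℚ(X) ≅ End^s_ℚ(X)`), read inside André's `†`-stable algebra `End_{ℚ-HS}(H•(X; ℚ))` in every degree at once; likewise the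
`†`-ANTI-relation `(M^*)† = (M′)^*` with `M′ = −M`-type constraints is decided on `E` (§2).

## What is proved

* §1 **`pullAlgHom_toLinearMap_injective`** (`M^* = L^* ⟹ M = L`), `pullAlgHom_toLinearMap_eq_iff`.
* §2 **`andreDagger_pullAlgHom_eq_pullAlgHom_iff`** (`(M^*)† = L^* ⟺ L = M′`), **`andreDagger_pullAlgHom_eq_self_iff`** (`(M^*)† = M^* ⟺ M′ = M`),
  `andreDagger_pullAlgHom_eq_self_iff_forall` (`⟺ ∀ u v, η(Mu, v) = η(u, Mv)`).
* §3 **`andreDagger_pullAlgHom_analyticRepReal_eq_self_iff`** (`(ρ(A)^*)† = ρ(A)^* ⟺ rosati (latticeGram Φ η) A = A`), and for a Riemann form with rational Gram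
  matrix `G`: `IsRiemannForm.andreDagger_pullAlgHom_analyticRepReal_ratCast_eq_self_iff` (`⟺ rosati G B = B`, rational `B`),
  `IsRiemannForm.andreDagger_pullAlgHom_analyticRepReal_endAlgRat_eq_self_iff` (`A ∈ End_ℚ(X)`: `⟺ rosatiQ A = A`).

## Sources, VERBATIM

* H. Lange, *Abelian Varieties over the Complex Numbers* (Springer 2023) [Lange2023AbelianVarietiesComplex], held `book:lange1992-complex-abelian-varieties`,
  §2.4.1 Prop. 2.4.2 (p. 113, quoted in row g53-#4); §2.4.3 (p0118 L1): "An element `f ∈ End_ℚ(X)` is called *symmetric* (with respect to `L₀`), if `f′ = f`";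
  §5.2 (Prop. 5.2.1: `NS_ℚ(X) → End^s_ℚ(X)` is an isomorphism).
* Y. André, *Pour une théorie inconditionnelle des motifs*, Publ. Math. IHÉS **83** (1996) [Andre1996Motifs], Prop. 3.3 (p. 21).
* F. W. Warner, *Foundations of Differentiable Manifolds and Lie Groups* (1983) [Warner1983], 2.22 (pull-backs; degree one is the transpose).

## Scope

`η` non-degenerate only (a Riemann form in the `IsRiemannForm` corollaries); nothing is said about the Néron–Severi group itself (the identification
`NS_ℚ(X) ≅ End^s_ℚ(X)` is quoted for orientation, not restated).
-/

noncomputable section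

-- `Module ℂ` / `SMulZeroClass ℂ` synthesis on `E [⋀^Fin k]→L[ℝ] ℂ` (as in `ComplexTorusLefschetzDecomposition`)
set_option maxSynthPendingDepth 3

namespace Literature.Geometry.Kaehler

namespace ComplexTorus

open Module Function Finset
open Literature.LinearAlgebra.Alternating Literature.Algebra.Lie Literature.Analysis.Complex

universe uE

variable {ι : Type*} [Fintype ι] [DecidableEq ι] {E : Type uE} [NormedAddCommGroup E] [NormedSpace ℂ E] [FiniteDimensional ℂ E]
  (Φ : (ι → ℝ) ≃L[ℝ] E) {η : E [⋀^Fin 2]→L[ℝ] ℝ} {N : ℕ}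

/-! ## §1 `M ↦ M^*` is injective -/

section Injective

omit [FiniteDimensional ℂ E] in
/-- **`M^* = L^* ⟹ M = L`**: the pull-back on `H•(X; ℂ)` determines the real-linear map (on `H¹`, `M^*(θ ∧ 1) = (θ ∘ M) ∧ 1`, and the real covectors separate the
points of `E`). [cite: Warner1983, 2.22] -/
theorem pullAlgHom_toLinearMap_injective : Injective fun M : E →L[ℝ] E ↦ (GForm.pullAlgHom M).toLinearMap := by
  intro M L h
  ext v
  by_contra hne
  obtain ⟨θ, hθ⟩ := SeparatingDual.exists_ne_zero (R := ℝ) (sub_ne_zero.2 hne)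
  have h1 := LinearMap.congr_fun h (GForm.of 1 (GForm.hat θ))
  simp only [AlgHom.toLinearMap_apply, GForm.pullAlgHom_apply, GForm.pullG_of] at h1
  have h2 := congrArg (fun x : E [⋀^Fin 1]→L[ℝ] ℂ ↦ x ![v]) (GForm.of_injective 1 h1)
  simp only [ContinuousAlternatingMap.compContinuousLinearMap_apply, GForm.hat_apply, comp_apply, Matrix.cons_val_zero, Complex.ofReal_inj] at h2
  exact hθ (by rw [map_sub, h2, sub_self])

omit [FiniteDimensional ℂ E] in
/-- `M^* = L^* ⟺ M = L`. [cite: Warner1983, 2.22] -/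
theorem pullAlgHom_toLinearMap_eq_iff {M L : E →L[ℝ] E} : (GForm.pullAlgHom M).toLinearMap = (GForm.pullAlgHom L).toLinearMap ↔ M = L :=
  ⟨fun h ↦ pullAlgHom_toLinearMap_injective h, fun h ↦ by rw [h]⟩

end Injective

/-! ## §2 `†`-self-adjoint pull-backs -/

section SelfAdjoint

variable [Nontrivial E] (hη : ∀ v : E, v ≠ 0 → ∃ w : E, η ![v, w] ≠ 0)

/-- **`(M^*)† = L^* ⟺ L = M′`** (`M′` the `η`-adjoint of `M`). [cite: Andre1996Motifs, Prop. 3.3 (p. 21)] [cite: Lange2023AbelianVarietiesComplex, §2.4.1 Prop. 2.4.2] -/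
theorem andreDagger_pullAlgHom_eq_pullAlgHom_iff (e : Fin N ≃ ι) {M M' : E →L[ℝ] E} (hMM' : ∀ u v : E, η ![M u, v] = η ![u, M' v]) {L : E →L[ℝ] E} :
    andreDagger Φ hη e (GForm.pullAlgHom M).toLinearMap = (GForm.pullAlgHom L).toLinearMap ↔ L = M' := by
  rw [andreDagger_pullAlgHom Φ hη e hMM', pullAlgHom_toLinearMap_eq_iff, eq_comm]

/-- **`(M^*)† = M^* ⟺ M′ = M`: the `†`-SELF-ADJOINT pull-backs are exactly the pull-backs by `η`-self-adjoint maps** (Lange's symmetric elements `f′ = f`).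
[cite: Lange2023AbelianVarietiesComplex, §2.4.3 (p. 118: "symmetric … if `f′ = f`")] [cite: Andre1996Motifs, Prop. 3.3 (p. 21)] -/
theorem andreDagger_pullAlgHom_eq_self_iff (e : Fin N ≃ ι) {M M' : E →L[ℝ] E} (hMM' : ∀ u v : E, η ![M u, v] = η ![u, M' v]) :
    andreDagger Φ hη e (GForm.pullAlgHom M).toLinearMap = (GForm.pullAlgHom M).toLinearMap ↔ M' = M := by
  rw [andreDagger_pullAlgHom_eq_pullAlgHom_iff Φ hη e hMM', eq_comm]

/-- **`(M^*)† = M^* ⟺ η(Mu, v) = η(u, Mv)` for all `u, v`.** [cite: Lange2023AbelianVarietiesComplex, §2.4.3 (p. 118), §5.2 Prop. 5.2.1] [cite: Andre1996Motifs, Prop. 3.3 (p. 21)] -/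
theorem andreDagger_pullAlgHom_eq_self_iff_forall (e : Fin N ≃ ι) {M M' : E →L[ℝ] E} (hMM' : ∀ u v : E, η ![M u, v] = η ![u, M' v]) :
    andreDagger Φ hη e (GForm.pullAlgHom M).toLinearMap = (GForm.pullAlgHom M).toLinearMap ↔ ∀ u v : E, η ![M u, v] = η ![u, M v] := by
  rw [andreDagger_pullAlgHom_eq_self_iff Φ hη e hMM']
  refine ⟨fun h u v ↦ by rw [hMM', h], fun h ↦ ?_⟩
  ext v
  exact eq_of_pair_eq hη fun u ↦ by rw [← hMM', h]

end SelfAdjoint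

/-! ## §3 On `End(X)`: `†`-symmetric = Rosati-symmetric -/

section Rosati

variable [Nontrivial E] (hη : ∀ v : E, v ≠ 0 → ∃ w : E, η ![v, w] ≠ 0)

omit [FiniteDimensional ℂ E] [Nontrivial E] in
/-- `A ↦ ρ(A) = Φ A Φ⁻¹` is injective (the analytic representation is faithful; restated privately, the tree's copy lives in the Weil-classes closure).
[cite: Lange2023AbelianVarietiesComplex, §1.2 (the analytic and rational representations are faithful)] -/
private theorem analyticRepReal_injective₆₄ {B C : Matrix ι ι ℝ} (h : analyticRepReal Φ Φ B = analyticRepReal Φ Φ C) : B = C := by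
  have hx : ∀ x, B.mulVec x = C.mulVec x := fun x ↦ Φ.injective (by rw [← analyticRepReal_apply Φ Φ B, ← analyticRepReal_apply Φ Φ C, h])
  exact Matrix.toLin'.injective (LinearMap.ext fun x ↦ by rw [Matrix.toLin'_apply, Matrix.toLin'_apply]; exact hx x)

/-- **`(ρ(A)^*)† = ρ(A)^* ⟺ A′ = A`** with `A′ = rosati (latticeGram Φ η) A = G_ℝ⁻¹ ᵗA G_ℝ`: on the real-analytic representations André's `†`-symmetric elements are
EXACTLY the Rosati-symmetric matrices, in every degree at once. [cite: Lange2023AbelianVarietiesComplex, §2.4.3 (p. 118), §5.2 Prop. 5.2.1] [cite: Andre1996Motifs, Prop. 3.3 (p. 21)] -/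
theorem andreDagger_pullAlgHom_analyticRepReal_eq_self_iff (e : Fin N ≃ ι) (A : Matrix ι ι ℝ) :
    andreDagger Φ hη e (GForm.pullAlgHom (analyticRepReal Φ Φ A)).toLinearMap = (GForm.pullAlgHom (analyticRepReal Φ Φ A)).toLinearMap ↔
      rosati (latticeGram Φ η) A = A := by
  rw [andreDagger_pullAlgHom_eq_self_iff Φ hη e (twoForm_analyticRepReal_rosati Φ hη A)]
  exact ⟨fun h ↦ analyticRepReal_injective₆₄ Φ h, fun h ↦ by rw [h]⟩

/-- For a Riemann form with rational Gram matrix `G`: **`(ρ(B_ℝ)^*)† = ρ(B_ℝ)^* ⟺ G⁻¹ ᵗB G = B`** for every RATIONAL matrix `B` (the rational Rosati involution `rosati G`).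
[cite: Lange2023AbelianVarietiesComplex, §2.4.3 (p. 118), §5.2 Prop. 5.2.1] [cite: Andre1996Motifs, Prop. 3.3 (p. 21)] -/
theorem IsRiemannForm.andreDagger_pullAlgHom_analyticRepReal_ratCast_eq_self_iff (hR : IsRiemannForm Φ η) {G : Matrix ι ι ℚ}
    (hG : G.map (Rat.cast : ℚ → ℝ) = latticeGram Φ η) (e : Fin N ≃ ι) (B : Matrix ι ι ℚ) :
    andreDagger Φ (hR.exists_apply_ne_zero Φ) e (GForm.pullAlgHom (analyticRepReal Φ Φ (B.map (Rat.cast : ℚ → ℝ)))).toLinearMap =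
        (GForm.pullAlgHom (analyticRepReal Φ Φ (B.map (Rat.cast : ℚ → ℝ)))).toLinearMap ↔ rosati G B = B := by
  rw [andreDagger_pullAlgHom_analyticRepReal_eq_self_iff Φ (hR.exists_apply_ne_zero Φ) e, ← map_ratCast_rosati hG hR.isUnit_det_latticeGram]
  exact ⟨fun h ↦ Matrix.map_injective Rat.cast_injective h, fun h ↦ by rw [h]⟩

/-- For `A ∈ End_ℚ(X) = endAlgRat Φ`: **`(ρ(A)^*)† = ρ(A)^* ⟺ A′ = A`** with `A′ = rosatiQ A` — André's `†`-symmetric elements of the image of `End_ℚ(X)` in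
`End_{ℚ-HS}(H•(X; ℚ))` are Lange's symmetric endomorphisms `End^s_ℚ(X) ≅ NS_ℚ(X)`. [cite: Lange2023AbelianVarietiesComplex, §2.4.3 (p. 118), §5.2 Prop. 5.2.1]
[cite: Andre1996Motifs, Prop. 3.3 (p. 21)] -/
theorem IsRiemannForm.andreDagger_pullAlgHom_analyticRepReal_endAlgRat_eq_self_iff (hR : IsRiemannForm Φ η) {G : Matrix ι ι ℚ}
    (hG : G.map (Rat.cast : ℚ → ℝ) = latticeGram Φ η) (e : Fin N ≃ ι) (A : endAlgRat Φ) :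
    andreDagger Φ (hR.exists_apply_ne_zero Φ) e (GForm.pullAlgHom (analyticRepReal Φ Φ ((A : Matrix ι ι ℚ).map (Rat.cast : ℚ → ℝ)))).toLinearMap =
        (GForm.pullAlgHom (analyticRepReal Φ Φ ((A : Matrix ι ι ℚ).map (Rat.cast : ℚ → ℝ)))).toLinearMap ↔ rosatiQ hR hG A = A := by
  rw [hR.andreDagger_pullAlgHom_analyticRepReal_ratCast_eq_self_iff Φ hG e, ← coe_rosatiQ (hη := hR) (hG := hG), Subtype.coe_inj]

end Rosati

end ComplexTorus

end Literature.Geometry.Kaehler
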